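import Mathlib
import HarnessLib
import Summits.Ventures.LatticeQCDFlow.Exactness.NCMCGeneralSpacePhaseChordRecursion

/-!
# An EXPLICIT `τ_int` floor for every event under any Doeblin power: `τ_int(setACF κ π A) ≥ min(sin²(π p), e/m²) / (8 π² p (1 − p))` (`p = π(A)`, `κ^m(x, ·) ≥ ε ν`, `e = ε.toReal`)

HONEST FRAMING: exact (Metropolis-corrected) sampling algorithms for lattice gauge theory;
figures of merit are autocorrelation/cost numbers at stated couplings and volumes; no
continuum-physics claim.

Venture `LatticeQCDFlow` (cell pub-lqcd), topic `Exactness`; FANOUT row 13 (`eng-snf`, GEN-21).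
NEW WORK of the cell, not a published result; no definition is introduced; nothing is cited as a
fact.  GEN-21's `NCMCGeneralSpaceEventTauIntPositive` proved `0 < τ_int(setACF κ π A)` for every
event under a Doeblin power by a rigidity argument on the phase `fract ∘ h` and claimed no constant.
ITS MODULE DOCSTRING'S PARENTHETICAL "none exists at this generality" IS WRONG AND IS HEREBY
CORRECTED: the rigidity argument is quantitative once the phase is read on the unit circle.  With `h`
the bounded Poisson solution for `1_A − p`, `Φ = e^{2πi h}`, `ω = e^{2πi p}`, and
`D = E_π |Φ(X₁) − ω Φ(X₀)|² = ∫_π ∫_κ 4 sin²(π(h(y) − h(x) − p))`: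
(1) `D ≤ 4π² σ²` (`σ² = π(h²) − π((κh)²) = 2 τ_int p(1 − p)`): `h(y) − h(x) − p` differs from the
martingale increment `h(y) − κh(x)` by the integer `1_A(x)`, and `|e^{it} − 1| ≤ |t|`;
(2) `D_m = E_π|Φ(X_m) − ω^m Φ(X₀)|² ≤ m² D` (triangle inequality along the path, file
`NCMCGeneralSpacePhaseChordRecursion`);
(3) `D_m ≥ e (2 − 2R)` with `R = |E_π Φ|` (minorisation: with probability `ε` the `m`-th point is a
fresh `ν`-sample, and `|E_ν Φ| ≤ 1`);
(4) `|1 − ω|² R² ≤ D` (stationarity: `E_π Φ(X₁) = E_π Φ(X₀)`, so `(1 − ω) E_π Φ = −E(Φ(X₁) − ωΦ(X₀))`);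
hence `D ≥ min(|1 − ω|²/4, e/m²) = min(sin²(πp), e/m²)` (according as `R > ½` or `R ≤ ½`) and
`τ_int ≥ min(sin²(πp), e/m²) / (8π² p(1 − p))`.

## Content

* §1 `integral_chord_nu_eq`, **`chord_nHit_ge_of_minorised`** — step (3):
  `e (2 − 2 √(c_π² + s_π²)) ≤ D_m` (`c_π = ∫ cos 2πθ dπ`, `s_π = ∫ sin 2πθ dπ`).
* §2 **`sin_sq_mul_meanPhase_le_chordOne`** — step (4): `4 sin²(πq) (c_π² + s_π²) ≤ D` (invariance only).
* §3 **`tauInt_setACF_ge_of_nHit`** — THE FLOOR: `κ` Markov, `π` invariant, `ε • ν ≤ (nHit κ m)(z, ·)`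
  for all `z` (`ε ≠ 0`, `0 < m`), `A` measurable with `0 < π(A) < 1`:
  `min (sin²(π · π(A))) (ε.toReal / m²) / (8 π² π(A)(1 − π(A))) ≤ Scoring.tauInt (setACF κ π A)`;
  `greenKubo_variance_indicator_ge_of_nHit` — the same as `σ² ≥ min(…)/(4π²)`.

NOT CLAIMED: optimality of the constant (it is a FLOOR against anti-correlation; a slowly mixing
chain has `τ_int` far above it); general bounded observables (false: see
`NCMCGeneralSpaceAsymptoticVarianceCounterexample`); unbounded observables; anything numerical.
-/

namespace Summit.Ventures.LatticeQCDFlow.Exactness.GeneralNCMC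

open MeasureTheory ProbabilityTheory Set Filter Finset
open scoped ENNReal NNReal Topology

variable {S : Type*} [MeasurableSpace S]

/-! ## §1 Step (3): the minorised `m`-th step sees a fresh phase -/

section Minorised

variable {κ : Kernel S S} [IsMarkovKernel κ] {π : Measure S} [IsProbabilityMeasure π]
  {ν : Measure S} [IsProbabilityMeasure ν] {ε : ℝ≥0∞} {m : ℕ}

omit [MeasurableSpace S] in
/-- Pointwise: `4 sin²(π(θ y − θ x − c)) = 2 − 2 cos β cos(2πθ y) − 2 sin β sin(2πθ y)` with
`β = 2π(θ x + c)`. -/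
theorem chord_eq_expand (θ : S → ℝ) (c : ℝ) (x y : S) :
    4 * Real.sin (Real.pi * (θ y - θ x - c)) ^ 2
      = 2 - 2 * (Real.cos (2 * Real.pi * θ x + 2 * Real.pi * c) * Real.cos (2 * Real.pi * θ y))
          - 2 * (Real.sin (2 * Real.pi * θ x + 2 * Real.pi * c) * Real.sin (2 * Real.pi * θ y)) := by
  rw [← chord_sq_expand, chord_sq_eq]
  congr 2
  ring

/-- The `ν`-average of the chord from `x`:
`∫ 4 sin²(π(θ y − θ x − c)) dν(y) = 2 − 2 cos β · c_ν − 2 sin β · s_ν`. -/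
theorem integral_chord_nu_eq (ν : Measure S) [IsProbabilityMeasure ν] {θ : S → ℝ} (hθ : Measurable θ)
    (c : ℝ) (x : S) :
    ∫ y, 4 * Real.sin (Real.pi * (θ y - θ x - c)) ^ 2 ∂ν
      = 2 - 2 * (Real.cos (2 * Real.pi * θ x + 2 * Real.pi * c) * ∫ y, Real.cos (2 * Real.pi * θ y) ∂ν)
          - 2 * (Real.sin (2 * Real.pi * θ x + 2 * Real.pi * c) * ∫ y, Real.sin (2 * Real.pi * θ y) ∂ν) := by
  have hcm : Measurable fun y => Real.cos (2 * Real.pi * θ y) := Real.measurable_cos.comp (hθ.const_mul _)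
  have hsm : Measurable fun y => Real.sin (2 * Real.pi * θ y) := Real.measurable_sin.comp (hθ.const_mul _)
  have hic : Integrable (fun y => 2 * (Real.cos (2 * Real.pi * θ x + 2 * Real.pi * c)
      * Real.cos (2 * Real.pi * θ y))) ν :=
    ((Scoring.integrable_of_bounded ν hcm fun y => Real.abs_cos_le_one _).const_mul _).const_mul _
  have his : Integrable (fun y => 2 * (Real.sin (2 * Real.pi * θ x + 2 * Real.pi * c)
      * Real.sin (2 * Real.pi * θ y))) ν :=
    ((Scoring.integrable_of_bounded ν hsm fun y => Real.abs_sin_le_one _).const_mul _).const_mul _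
  have hi1 : Integrable (fun y => (2 : ℝ) - 2 * (Real.cos (2 * Real.pi * θ x + 2 * Real.pi * c)
      * Real.cos (2 * Real.pi * θ y))) ν := (integrable_const _).sub hic
  simp_rw [chord_eq_expand θ c x]
  rw [integral_sub hi1 his, integral_sub (integrable_const _) hic, integral_const, probReal_univ,
    one_smul, integral_const_mul, integral_const_mul, integral_const_mul, integral_const_mul]

/-- **Step (3)**: under `ε • ν ≤ (nHit κ m)(x, ·)`, for every measurable phase `θ` and shift `c`:
`ε.toReal (2 − 2 √(c_π² + s_π²)) ≤ ∫_π ∫_{κ^m} 4 sin²(π(θ y − θ x − c))`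
(`c_π = ∫ cos(2πθ) dπ`, `s_π = ∫ sin(2πθ) dπ`). -/
theorem chord_nHit_ge_of_minorised (hmin : ∀ z, ε • ν ≤ nHit κ m z) {θ : S → ℝ} (hθ : Measurable θ)
    (c : ℝ) :
    ε.toReal * (2 - 2 * Real.sqrt ((∫ x, Real.cos (2 * Real.pi * θ x) ∂π) ^ 2
        + (∫ x, Real.sin (2 * Real.pi * θ x) ∂π) ^ 2))
      ≤ ∫ x, ∫ y, 4 * Real.sin (Real.pi * (θ y - θ x - c)) ^ 2 ∂(nHit κ m x) ∂π := by
  haveI := isMarkovKernel_nHit κ m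
  have he0 : 0 ≤ ε.toReal := ENNReal.toReal_nonneg
  set cπ := ∫ x, Real.cos (2 * Real.pi * θ x) ∂π with hcπ
  set sπ := ∫ x, Real.sin (2 * Real.pi * θ x) ∂π with hsπ
  set cν := ∫ y, Real.cos (2 * Real.pi * θ y) ∂ν with hcν
  set sν := ∫ y, Real.sin (2 * Real.pi * θ y) ∂ν with hsν
  -- pointwise in `x`: restrict the `m`-step law to its `ε ν` part
  have hpt : ∀ x, ε.toReal * (2 - 2 * (Real.cos (2 * Real.pi * θ x + 2 * Real.pi * c) * cν)
        - 2 * (Real.sin (2 * Real.pi * θ x + 2 * Real.pi * c) * sν))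
      ≤ ∫ y, 4 * Real.sin (Real.pi * (θ y - θ x - c)) ^ 2 ∂(nHit κ m x) := by
    intro x
    rw [← integral_chord_nu_eq ν hθ c x, ← smul_eq_mul, ← integral_smul_measure]
    exact integral_mono_measure (hmin x) (ae_of_all _ fun y => chord_nonneg c x y)
      (Scoring.integrable_of_bounded _ (measurable_chord_right hθ c x) (abs_chord_le c x))
  -- integrate over `π`
  have hθ' : Measurable fun x => 2 * Real.pi * θ x + 2 * Real.pi * c := (hθ.const_mul _).add_const _
  have hcm : Measurable fun x => Real.cos (2 * Real.pi * θ x + 2 * Real.pi * c) :=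
    Real.measurable_cos.comp hθ'
  have hsm : Measurable fun x => Real.sin (2 * Real.pi * θ x + 2 * Real.pi * c) :=
    Real.measurable_sin.comp hθ'
  have hic : Integrable (fun x => 2 * (Real.cos (2 * Real.pi * θ x + 2 * Real.pi * c) * cν)) π :=
    ((Scoring.integrable_of_bounded π hcm fun x => Real.abs_cos_le_one _).mul_const _).const_mul _
  have his : Integrable (fun x => 2 * (Real.sin (2 * Real.pi * θ x + 2 * Real.pi * c) * sν)) π :=
    ((Scoring.integrable_of_bounded π hsm fun x => Real.abs_sin_le_one _).mul_const _).const_mul _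
  have hi1 : Integrable (fun x => (2 : ℝ) - 2 * (Real.cos (2 * Real.pi * θ x + 2 * Real.pi * c) * cν)) π :=
    (integrable_const _).sub hic
  have hiL : Integrable (fun x => ε.toReal * (2 - 2 * (Real.cos (2 * Real.pi * θ x + 2 * Real.pi * c) * cν)
      - 2 * (Real.sin (2 * Real.pi * θ x + 2 * Real.pi * c) * sν))) π := (hi1.sub his).const_mul _
  have hiR : Integrable (fun x => ∫ y, 4 * Real.sin (Real.pi * (θ y - θ x - c)) ^ 2 ∂(nHit κ m x)) π :=
    Scoring.integrable_of_bounded π (measurable_integral_chord (nHit κ m) hθ c)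
      (abs_integral_chord_le (nHit κ m) c)
  have hint := integral_mono hiL hiR hpt
  -- evaluate the left side: `e (2 − 2 (c'_π cν + s'_π sν))`
  have hL : ∫ x, ε.toReal * (2 - 2 * (Real.cos (2 * Real.pi * θ x + 2 * Real.pi * c) * cν)
      - 2 * (Real.sin (2 * Real.pi * θ x + 2 * Real.pi * c) * sν)) ∂π
      = ε.toReal * (2 - 2 * ((Real.cos (2 * Real.pi * c) * cπ - Real.sin (2 * Real.pi * c) * sπ) * cν)
        - 2 * ((Real.sin (2 * Real.pi * c) * cπ + Real.cos (2 * Real.pi * c) * sπ) * sν)) := by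
    rw [integral_const_mul, integral_sub hi1 his, integral_sub (integrable_const _) hic, integral_const,
      probReal_univ, one_smul, integral_const_mul, integral_const_mul, integral_mul_const,
      integral_mul_const, integral_cos_add π (hθ.const_mul _), integral_sin_add π (hθ.const_mul _)]
  rw [hL] at hint
  refine le_trans (mul_le_mul_of_nonneg_left ?_ he0) hint
  -- `c' cν + s' sν ≤ √((c'² + s'²)(cν² + sν²)) ≤ √(cπ² + sπ²)`
  have hν1 : cν ^ 2 + sν ^ 2 ≤ 1 := sq_integral_cos_add_sq_integral_sin_le_one ν (hθ.const_mul _)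
  have hrot := rot_sq_eq (2 * Real.pi * c) cπ sπ
  -- two-dimensional Cauchy–Schwarz (Lagrange's identity)
  have hcs : ((Real.cos (2 * Real.pi * c) * cπ - Real.sin (2 * Real.pi * c) * sπ) * cν
        + (Real.sin (2 * Real.pi * c) * cπ + Real.cos (2 * Real.pi * c) * sπ) * sν) ^ 2
      ≤ ((Real.cos (2 * Real.pi * c) * cπ - Real.sin (2 * Real.pi * c) * sπ) ^ 2
        + (Real.sin (2 * Real.pi * c) * cπ + Real.cos (2 * Real.pi * c) * sπ) ^ 2) * (cν ^ 2 + sν ^ 2) := by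
    nlinarith [sq_nonneg ((Real.cos (2 * Real.pi * c) * cπ - Real.sin (2 * Real.pi * c) * sπ) * sν
      - (Real.sin (2 * Real.pi * c) * cπ + Real.cos (2 * Real.pi * c) * sπ) * cν)]
  rw [hrot] at hcs
  have hR0 : 0 ≤ cπ ^ 2 + sπ ^ 2 := by positivity
  have hdot : (Real.cos (2 * Real.pi * c) * cπ - Real.sin (2 * Real.pi * c) * sπ) * cν
      + (Real.sin (2 * Real.pi * c) * cπ + Real.cos (2 * Real.pi * c) * sπ) * sν
      ≤ Real.sqrt (cπ ^ 2 + sπ ^ 2) := by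
    apply Real.le_sqrt_of_sq_le
    exact hcs.trans (mul_le_of_le_one_right hR0 hν1)
  linarith

end Minorised

/-! ## §2 Step (4): stationarity ties the mean phase to the one-step chord -/

section Stationarity

variable {κ : Kernel S S} [IsMarkovKernel κ] {π : Measure S} [IsProbabilityMeasure π]

/-- **Step (4)**: for `π` invariant, every measurable phase `θ` and shift `q`:
`4 sin²(π q) (c_π² + s_π²) ≤ ∫_π ∫_κ 4 sin²(π(θ y − θ x − q))`. -/
theorem sin_sq_mul_meanPhase_le_chordOne (hπ : Kernel.Invariant κ π) {θ : S → ℝ} (hθ : Measurable θ)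
    (q : ℝ) :
    4 * Real.sin (Real.pi * q) ^ 2 * ((∫ x, Real.cos (2 * Real.pi * θ x) ∂π) ^ 2
        + (∫ x, Real.sin (2 * Real.pi * θ x) ∂π) ^ 2)
      ≤ ∫ x, ∫ y, 4 * Real.sin (Real.pi * (θ y - θ x - q)) ^ 2 ∂(κ x) ∂π := by
  set cπ := ∫ x, Real.cos (2 * Real.pi * θ x) ∂π with hcπ
  set sπ := ∫ x, Real.sin (2 * Real.pi * θ x) ∂π with hsπ
  set φ : ℝ := 2 * Real.pi * q with hφ
  have hα : Measurable fun x => 2 * Real.pi * θ x := hθ.const_mul _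
  have hcm : Measurable fun y => Real.cos (2 * Real.pi * θ y) := Real.measurable_cos.comp hα
  have hsm : Measurable fun y => Real.sin (2 * Real.pi * θ y) := Real.measurable_sin.comp hα
  have hcb : ∀ y, |Real.cos (2 * Real.pi * θ y)| ≤ 1 := fun y => Real.abs_cos_le_one _
  have hsb : ∀ y, |Real.sin (2 * Real.pi * θ y)| ≤ 1 := fun y => Real.abs_sin_le_one _
  have hcm' : Measurable fun x => Real.cos (2 * Real.pi * θ x + φ) := Real.measurable_cos.comp (hα.add_const _)
  have hsm' : Measurable fun x => Real.sin (2 * Real.pi * θ x + φ) := Real.measurable_sin.comp (hα.add_const _)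
  -- the two mean differences `Δc`, `Δs`
  have hKc := Scoring.measurable_kop κ hcm
  have hKs := Scoring.measurable_kop κ hsm
  have hKcb := Scoring.abs_kop_le κ hcb
  have hKsb := Scoring.abs_kop_le κ hsb
  have hUm : Measurable fun x => Scoring.kop κ (fun y => Real.cos (2 * Real.pi * θ y)) x
      - Real.cos (2 * Real.pi * θ x + φ) := hKc.sub hcm'
  have hVm : Measurable fun x => Scoring.kop κ (fun y => Real.sin (2 * Real.pi * θ y)) x
      - Real.sin (2 * Real.pi * θ x + φ) := hKs.sub hsm'
  have hUb : ∀ x, |Scoring.kop κ (fun y => Real.cos (2 * Real.pi * θ y)) x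
      - Real.cos (2 * Real.pi * θ x + φ)| ≤ 1 + 1 :=
    fun x => (abs_sub _ _).trans (add_le_add (hKcb x) (Real.abs_cos_le_one _))
  have hVb : ∀ x, |Scoring.kop κ (fun y => Real.sin (2 * Real.pi * θ y)) x
      - Real.sin (2 * Real.pi * θ x + φ)| ≤ 1 + 1 :=
    fun x => (abs_sub _ _).trans (add_le_add (hKsb x) (Real.abs_sin_le_one _))
  -- their values, by invariance
  have hΔc : ∫ x, (Scoring.kop κ (fun y => Real.cos (2 * Real.pi * θ y)) x
        - Real.cos (2 * Real.pi * θ x + φ)) ∂π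
      = cπ - (Real.cos φ * cπ - Real.sin φ * sπ) := by
    rw [integral_sub (Scoring.integrable_of_bounded π hKc hKcb)
      (Scoring.integrable_of_bounded π hcm' fun x => Real.abs_cos_le_one _),
      Scoring.integral_kop κ hπ hcm hcb, integral_cos_add π hα]
  have hΔs : ∫ x, (Scoring.kop κ (fun y => Real.sin (2 * Real.pi * θ y)) x
        - Real.sin (2 * Real.pi * θ x + φ)) ∂π
      = sπ - (Real.sin φ * cπ + Real.cos φ * sπ) := by
    rw [integral_sub (Scoring.integrable_of_bounded π hKs hKsb)
      (Scoring.integrable_of_bounded π hsm' fun x => Real.abs_sin_le_one _),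
      Scoring.integral_kop κ hπ hsm hsb, integral_sin_add π hα]
  -- Jensen twice: `Δc² ≤ ∫ (∫_κ u)² ≤ ∫ ∫_κ u²`, same for `Δs`
  have hJc := sq_integral_le_integral_sq π hUm hUb
  have hJs := sq_integral_le_integral_sq π hVm hVb
  have hinner : ∀ x, (Scoring.kop κ (fun y => Real.cos (2 * Real.pi * θ y)) x
        - Real.cos (2 * Real.pi * θ x + φ)) ^ 2
      + (Scoring.kop κ (fun y => Real.sin (2 * Real.pi * θ y)) x - Real.sin (2 * Real.pi * θ x + φ)) ^ 2
      ≤ ∫ y, 4 * Real.sin (Real.pi * (θ y - θ x - q)) ^ 2 ∂(κ x) := by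
    intro x
    have hum : Measurable fun y => Real.cos (2 * Real.pi * θ y) - Real.cos (2 * Real.pi * θ x + φ) :=
      hcm.sub_const _
    have hvm : Measurable fun y => Real.sin (2 * Real.pi * θ y) - Real.sin (2 * Real.pi * θ x + φ) :=
      hsm.sub_const _
    have hub : ∀ y, |Real.cos (2 * Real.pi * θ y) - Real.cos (2 * Real.pi * θ x + φ)| ≤ 1 + 1 :=
      fun y => (abs_sub _ _).trans (add_le_add (Real.abs_cos_le_one _) (Real.abs_cos_le_one _))
    have hvb : ∀ y, |Real.sin (2 * Real.pi * θ y) - Real.sin (2 * Real.pi * θ x + φ)| ≤ 1 + 1 :=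
      fun y => (abs_sub _ _).trans (add_le_add (Real.abs_sin_le_one _) (Real.abs_sin_le_one _))
    have hu : ∫ y, (Real.cos (2 * Real.pi * θ y) - Real.cos (2 * Real.pi * θ x + φ)) ∂(κ x)
        = Scoring.kop κ (fun y => Real.cos (2 * Real.pi * θ y)) x - Real.cos (2 * Real.pi * θ x + φ) := by
      rw [integral_sub (Scoring.integrable_of_bounded _ hcm hcb) (integrable_const _), integral_const,
        probReal_univ, one_smul]
      rfl
    have hv : ∫ y, (Real.sin (2 * Real.pi * θ y) - Real.sin (2 * Real.pi * θ x + φ)) ∂(κ x)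
        = Scoring.kop κ (fun y => Real.sin (2 * Real.pi * θ y)) x - Real.sin (2 * Real.pi * θ x + φ) := by
      rw [integral_sub (Scoring.integrable_of_bounded _ hsm hsb) (integrable_const _), integral_const,
        probReal_univ, one_smul]
      rfl
    have h1 := sq_integral_le_integral_sq (κ x) hum hub
    have h2 := sq_integral_le_integral_sq (κ x) hvm hvb
    rw [hu] at h1
    rw [hv] at h2
    have hsum : ∫ y, (Real.cos (2 * Real.pi * θ y) - Real.cos (2 * Real.pi * θ x + φ)) ^ 2 ∂(κ x)
        + ∫ y, (Real.sin (2 * Real.pi * θ y) - Real.sin (2 * Real.pi * θ x + φ)) ^ 2 ∂(κ x)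
        = ∫ y, 4 * Real.sin (Real.pi * (θ y - θ x - q)) ^ 2 ∂(κ x) := by
      rw [← integral_add (Scoring.integrable_of_bounded _ (hum.pow_const 2) (C := (1 + 1) ^ 2) fun y => by
            rw [abs_pow]; exact pow_le_pow_left₀ (abs_nonneg _) (hub y) 2)
          (Scoring.integrable_of_bounded _ (hvm.pow_const 2) (C := (1 + 1) ^ 2) fun y => by
            rw [abs_pow]; exact pow_le_pow_left₀ (abs_nonneg _) (hvb y) 2)]
      refine integral_congr_ae (ae_of_all _ fun y => ?_)
      show (Real.cos (2 * Real.pi * θ y) - Real.cos (2 * Real.pi * θ x + φ)) ^ 2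
          + (Real.sin (2 * Real.pi * θ y) - Real.sin (2 * Real.pi * θ x + φ)) ^ 2
        = 4 * Real.sin (Real.pi * (θ y - θ x - q)) ^ 2
      rw [chord_sq_eq, hφ]
      congr 2; ring
    linarith
  have hi2 : Integrable (fun x => (Scoring.kop κ (fun y => Real.cos (2 * Real.pi * θ y)) x
        - Real.cos (2 * Real.pi * θ x + φ)) ^ 2
      + (Scoring.kop κ (fun y => Real.sin (2 * Real.pi * θ y)) x - Real.sin (2 * Real.pi * θ x + φ)) ^ 2) π :=
    (Scoring.integrable_of_bounded π (hUm.pow_const 2) (C := (1 + 1) ^ 2) fun x => by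
        rw [abs_pow]; exact pow_le_pow_left₀ (abs_nonneg _) (hUb x) 2).add
      (Scoring.integrable_of_bounded π (hVm.pow_const 2) (C := (1 + 1) ^ 2) fun x => by
        rw [abs_pow]; exact pow_le_pow_left₀ (abs_nonneg _) (hVb x) 2)
  have hint := integral_mono hi2 (Scoring.integrable_of_bounded π (measurable_integral_chord κ hθ q)
    (abs_integral_chord_le κ q)) hinner
  rw [integral_add (Scoring.integrable_of_bounded π (hUm.pow_const 2) (C := (1 + 1) ^ 2) fun x => by
        rw [abs_pow]; exact pow_le_pow_left₀ (abs_nonneg _) (hUb x) 2)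
      (Scoring.integrable_of_bounded π (hVm.pow_const 2) (C := (1 + 1) ^ 2) fun x => by
        rw [abs_pow]; exact pow_le_pow_left₀ (abs_nonneg _) (hVb x) 2)] at hint
  rw [hΔc] at hJc
  rw [hΔs] at hJs
  -- `Δc² + Δs² = (2 − 2cos φ)(cπ² + sπ²) = 4 sin²(πq)(cπ² + sπ²)`
  have hid := sub_rot_sq_eq φ cπ sπ
  rw [hφ, four_sin_sq_pi_eq] at hid
  rw [← hφ] at hid
  linarith

end Stationarity

/-! ## §3 The floor -/

section Floor

variable {κ : Kernel S S} [IsMarkovKernel κ] {π : Measure S} [IsProbabilityMeasure π]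
  {ν : Measure S} [IsProbabilityMeasure ν] {ε : ℝ≥0∞} {m : ℕ}

/-- **THE EXPLICIT `τ_int` FLOOR FOR EVENTS UNDER A DOEBLIN POWER.**  `κ` Markov with invariant
probability law `π`, `ε • ν ≤ (nHit κ m)(z, ·)` for all `z` (`ε ≠ 0`, `0 < m`), `A` measurable with
`0 < π(A) < 1`.  Then
`min (sin²(π · π(A))) (ε.toReal / m²) / (8 π² · π(A) (1 − π(A))) ≤ Scoring.tauInt (setACF κ π A)`. -/
theorem tauInt_setACF_ge_of_nHit (hπ : Kernel.Invariant κ π) (hε : ε ≠ 0)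
    (hmin : ∀ z, ε • ν ≤ nHit κ m z) (hm : 0 < m) {A : Set S} (hA : MeasurableSet A)
    (h0 : 0 < π.real A) (h1 : π.real A < 1) :
    min (Real.sin (Real.pi * π.real A) ^ 2) (ε.toReal / (m : ℝ) ^ 2)
        / (8 * Real.pi ^ 2 * (π.real A * (1 - π.real A)))
      ≤ Scoring.tauInt (setACF κ π A) := by
  haveI : Nonempty S := nonempty_of_isProbabilityMeasure π
  have hε1 : ε ≤ 1 := by
    haveI := isMarkovKernel_nHit κ m
    exact eps_le_one_of_minorised hmin
  have hε0 : 0 < ε := pos_iff_ne_zero.2 hε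
  have hminS : ∀ x {B : Set S}, MeasurableSet B → ε * ν B ≤ nHit κ m x B :=
    fun z B hB => minorised_setwise hmin z hB
  have he0 : 0 ≤ ε.toReal := ENNReal.toReal_nonneg
  set p : ℝ := π.real A with hp
  have hv0 : 0 < p * (1 - p) := mul_pos h0 (sub_pos.2 h1)
  have hm1 : (1 : ℝ) ≤ m := by exact_mod_cast hm
  -- the indicator observable and its Poisson solution
  have hf : Measurable (A.indicator (1 : S → ℝ)) := measurable_one.indicator hA
  have hC : ∀ y, |A.indicator (1 : S → ℝ) y| ≤ 1 := fun y => by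
    by_cases hy : y ∈ A <;> simp [hy]
  have hmean : ∫ z, A.indicator (1 : S → ℝ) z ∂π = p := integral_indicator_one hA
  obtain ⟨hfb, hCfb, hfb0⟩ := Scoring.centred_observable_bounds π hf hC
  obtain ⟨h, hhm, hhb, hpois⟩ := poisson_exists_of_nHit hminS hε0 hε1 hm hπ hfb hCfb hfb0
  have hGK := integral_sq_sub_sq_kop_eq_greenKubo_of_nHit hminS hε0 hε1 hm hπ hfb hCfb hfb0
    hhm hhb hpois
  -- `σ² = 2 τ p (1 − p)`
  have hσ : ∫ x, h x ^ 2 ∂π - ∫ x, (Scoring.kop κ h x) ^ 2 ∂π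
      = 2 * Scoring.tauInt (setACF κ π A) * (p * (1 - p)) := by
    rw [hGK, hp, ← greenKubo_indicator_eq_tauInt hπ hA h0 h1]
    unfold Scoring.autocov
    rfl
  -- the Poisson-type step hypothesis: `h x + p − κh x = 1_A x ∈ {0, 1}`
  have hstep : ∀ x, h x + p - Scoring.kop κ h x = 0 ∨ h x + p - Scoring.kop κ h x = 1 := by
    intro x
    have hx := hpois x
    rw [hmean] at hx
    by_cases hxA : x ∈ A
    · right; rw [Set.indicator_of_mem hxA, Pi.one_apply] at hx; linarith
    · left; rw [Set.indicator_of_notMem hxA] at hx; linarith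
  -- the four steps
  have hD1 := chordOne_le_condVar hπ hhm hhb hstep
  have hD2 := chord_nHit_le (κ := κ) hπ hhm p (Nat.one_le_of_lt hm)
  have hD3 := chord_nHit_ge_of_minorised (π := π) hmin hhm ((m : ℝ) * p)
  have hD4 := sin_sq_mul_meanPhase_le_chordOne hπ hhm p
  set D := ∫ x, ∫ y, 4 * Real.sin (Real.pi * (h y - h x - p)) ^ 2 ∂(κ x) ∂π with hDdef
  set R2 := (∫ x, Real.cos (2 * Real.pi * h x) ∂π) ^ 2 + (∫ x, Real.sin (2 * Real.pi * h x) ∂π) ^ 2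
    with hR2
  have hR2_0 : 0 ≤ R2 := by positivity
  have hD0 : 0 ≤ D := integral_nonneg fun x => integral_chord_nonneg κ p x
  -- `D ≥ min(sin²(πp), e/m²)`
  have hDge : min (Real.sin (Real.pi * p) ^ 2) (ε.toReal / (m : ℝ) ^ 2) ≤ D := by
    have hm2 : (0 : ℝ) < (m : ℝ) ^ 2 := by positivity
    by_cases hR : Real.sqrt R2 ≤ 1 / 2
    · -- fresh-phase branch: `e ≤ e(2 − 2R) ≤ D_m ≤ m² D`
      have h3 : ε.toReal ≤ (m : ℝ) ^ 2 * D := by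
        have : ε.toReal * 1 ≤ ε.toReal * (2 - 2 * Real.sqrt R2) :=
          mul_le_mul_of_nonneg_left (by linarith) he0
        linarith [hD3, hD2]
      calc min (Real.sin (Real.pi * p) ^ 2) (ε.toReal / (m : ℝ) ^ 2) ≤ ε.toReal / (m : ℝ) ^ 2 :=
            min_le_right _ _
        _ ≤ D := by rw [div_le_iff₀ hm2]; linarith
    · -- stationary branch: `R > ½`, `4 sin²(πp) R² ≤ D`
      rw [not_le] at hR
      have hR2' : 1 / 4 < R2 := by
        have hs := Real.sq_sqrt hR2_0
        nlinarith [hR, Real.sqrt_nonneg R2]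
      calc min (Real.sin (Real.pi * p) ^ 2) (ε.toReal / (m : ℝ) ^ 2) ≤ Real.sin (Real.pi * p) ^ 2 :=
            min_le_left _ _
        _ ≤ D := by nlinarith [hD4, sq_nonneg (Real.sin (Real.pi * p))]
  -- conclude: `2 τ p(1 − p) = σ² ≥ D/(4π²)`
  have hpi : 0 < Real.pi ^ 2 := by positivity
  have hσge : min (Real.sin (Real.pi * p) ^ 2) (ε.toReal / (m : ℝ) ^ 2)
      ≤ 4 * Real.pi ^ 2 * (2 * Scoring.tauInt (setACF κ π A) * (p * (1 - p))) := by
    rw [← hσ]; linarith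
  rw [div_le_iff₀ (by positivity)]
  linarith

/-- **The Green–Kubo variance of a centred indicator has an explicit floor under a Doeblin
power**: `min(sin²(π p), e/m²) / (4 π²) ≤ C_f̄(0) + 2 Σ' C_f̄(t+1)` for `f = 1_A`, `p = π(A) ∈ (0,1)`. -/
theorem greenKubo_variance_indicator_ge_of_nHit (hπ : Kernel.Invariant κ π) (hε : ε ≠ 0)
    (hmin : ∀ z, ε • ν ≤ nHit κ m z) (hm : 0 < m) {A : Set S} (hA : MeasurableSet A)
    (h0 : 0 < π.real A) (h1 : π.real A < 1) :
    min (Real.sin (Real.pi * π.real A) ^ 2) (ε.toReal / (m : ℝ) ^ 2) / (4 * Real.pi ^ 2)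
      ≤ Scoring.autocov κ π (fun y => A.indicator (1 : S → ℝ) y - ∫ z, A.indicator 1 z ∂π) 0
        + 2 * ∑' t, Scoring.autocov κ π
          (fun y => A.indicator (1 : S → ℝ) y - ∫ z, A.indicator 1 z ∂π) (t + 1) := by
  rw [← cltVariance_eq_autocov κ π, greenKubo_indicator_eq_tauInt hπ hA h0 h1]
  have hτ := tauInt_setACF_ge_of_nHit hπ hε hmin hm hA h0 h1
  have hv0 : 0 < π.real A * (1 - π.real A) := mul_pos h0 (sub_pos.2 h1)
  have hpi : 0 < Real.pi ^ 2 := by positivity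
  rw [div_le_iff₀ (by positivity)] at hτ
  rw [div_le_iff₀ (by positivity)]
  linarith

end Floor

end Summit.Ventures.LatticeQCDFlow.Exactness.GeneralNCMC
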